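import Summits.AtomisticToContinuum.Crystallization.Theorems.FrustratedLawDichotomyStrainedPatchHomCoords

/-!
# Site-level certificate interface for an ADMISSIBLE homogeneous ball (the `(R)` witness side)
# (27623 strained-patch piece; decomp-a2c, prover hand 2, generation 20 — (R)-side twin of the (H) prune interface)

`(R) TextureReliefBound L B` follows from a plain floor number plus ONE realised ADMISSIBLE homogeneous ball (`…HomRelief`).  Admissibility
asks, at EVERY member / reach site of the ball, the NEGATIONS of the prune clauses: not `1/20`-good (all members, all reach sites), `1/8`-good
(members), not removal-unstable and not one-atom-move-unstable (reach sites).  This DEF-FREE module provides the SITE-level transfers from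
parametric (displacement-set) data, with the homogeneity radius as a parameter — reach sites lie up to `63/10` from the centre, so only radius
`7` (closed) of homogeneity is available there (`63/10 + 7 = 133/10`):

* §1 local homogeneity at ANY site of an fcc / hcp ball within `ρ` of the centre, open radius `r` with `r + ρ ≤ 133/10` and the CLOSED variant;
  the closed-ball version of the site-sum lemma (`sum_eq_finsum_mem_of_locHom_closed`) and the windowed local sums at a site (`localSum_site_eq_windowSum`);
* §2 ★ `not_goodAtScale_site_of_radialSpread` — the radial-spread obstruction with homogeneity radius `r > max (‖w₀‖, ‖w‖, D)` only;
* §3 ★ `not_removalUnstableCore_site_of_windowSum_le` (ONE inequality) and ★ `not_moveUnstableCore_site_of_stable` (the one-atom MOVE-STABILITY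
  hypothesis in window form: `∀ q, ‖q‖ ≤ s → ‖q‖ < 7/10 → Σ_w V_LJ‖v‖ ≤ Σ_w V_LJ‖q − v‖ + s(7/(7−s))⁷S₇♯(7)` — the 3-dimensional continuous
  certificate, kept as a hypothesis).

0 sorry; no definitions; axioms ⊆ {propext, Classical.choice, Quot.sound}.  `--supports stmt-AtomisticToContinuum-27623`.
-/

noncomputable section

namespace Summit.AtomisticToContinuum.Crystallization.Theorems.FrustratedLawDichotomyStrainedPatchHomWitnessSite

open scoped BigOperators Classical
open Literature.MathematicalPhysics.StatisticalMechanics (lennardJones)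
open Literature.Geometry.DiscreteGeometry
  (fccKissingPattern hcpKissingPattern norm_eq_one_of_mem_fccKissingPattern norm_eq_one_of_mem_hcpKissingPattern)
open Summit.AtomisticToContinuum.Crystallization.Theorems.ChargedEnergyGapNegative (E3)
open Summit.AtomisticToContinuum.Crystallization.Theorems.FrustratedLawDichotomyMotifLemmas (GoodAtScale)
open Summit.AtomisticToContinuum.Crystallization.Theorems.FrustratedLawDichotomyAveragingCut (ball mem_ball)
open Summit.AtomisticToContinuum.Crystallization.Theorems.FrustratedLawDichotomyExemptAbsorptionRecord (MoveUnstableCore RemovalUnstableCore)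
open Summit.AtomisticToContinuum.Crystallization.Theorems.FrustratedLawDichotomyExemptLocalSharp (tailConstSharp)
open Summit.AtomisticToContinuum.Crystallization.Theorems.FrustratedLawDichotomyStrainedPatchHomSplit
open Summit.AtomisticToContinuum.Crystallization.Theorems.FrustratedLawDichotomyStrainedPatchHomLattice
open Literature.Barriers.AtomisticToContinuum.FlatleyTheil2015 (fccVec)

/-! ## §1. Local homogeneity at an arbitrary site, open and closed radius -/

/-- ★ **Closed-ball site sums**: if within CLOSED distance `R` of `z j` the point set is `z j + T`, then `Σ_k g(z k − z j) = ∑ᶠ v ∈ T, g v` for every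
kernel vanishing for `‖v‖ > R`. [folklore] -/
theorem sum_eq_finsum_mem_of_locHom_closed {M : ℕ} {z : Fin M → E3} (hz : Function.Injective z) {j : Fin M} {T : Set E3} {R : ℝ}
    (hT : ∀ x : E3, dist x (z j) ≤ R → (x ∈ Set.range z ↔ x - z j ∈ T)) (g : E3 → ℝ) (hg : ∀ v : E3, R < ‖v‖ → g v = 0) :
    ∑ k : Fin M, g (z k - z j) = ∑ᶠ v ∈ T, g v := by
  rw [sum_eq_finsum_mem_image hz j g]
  apply finsum_mem_inter_support_eq'
  intro v hv
  have hvR : ‖v‖ ≤ R := le_of_not_gt fun h => hv (hg v h)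
  have hd : dist (v + z j) (z j) ≤ R := by simpa [dist_eq_norm] using hvR
  constructor
  · rintro ⟨x, hx, rfl⟩
    have hdx : dist x (z j) ≤ R := by simpa using hd
    exact (hT x hdx).1 hx
  · intro hvT
    exact ⟨v + z j, (hT (v + z j) hd).2 (by simpa using hvT), by simp⟩

/-- ★ **fcc ball, any site, open radius**: a site `k` within `ρ` of the centre sees, within `r` (`r + ρ ≤ 133/10`), exactly `z k + G·L_fcc`. [folklore] -/
theorem locHom_fcc_site {M : ℕ} {z : Fin M → E3} {c k : Fin M} {G : E3 →L[ℝ] E3} {ρ r : ℝ}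
    (hrange : Set.range z = {x : E3 | dist x (z c) ≤ 133 / 10 ∧ ∃ a : Fin 3 → ℤ, x = z c + latPt G fccVec a})
    (hk : dist (z k) (z c) ≤ ρ) (hr : r + ρ ≤ 133 / 10) :
    ∀ x : E3, dist x (z k) < r → (x ∈ Set.range z ↔ x - z k ∈ {v : E3 | ∃ b : Fin 3 → ℤ, v = latPt G fccVec b}) := by
  have hkmem : z k ∈ Set.range z := ⟨k, rfl⟩
  rw [hrange] at hkmem
  obtain ⟨-, ak, hak⟩ := hkmem
  intro x hx
  rw [hrange]
  constructor
  · rintro ⟨-, a, ha⟩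
    exact ⟨a - ak, by rw [latPt_sub, ha, hak]; abel⟩
  · rintro ⟨b, hb⟩
    refine ⟨by linarith [dist_triangle x (z k) (z c)], ak + b, ?_⟩
    rw [latPt_add, ← sub_add_cancel x (z k), hb, hak]
    abel

/-- ★ **fcc ball, any site, CLOSED radius** (`r + ρ ≤ 133/10`). [folklore] -/
theorem locHom_fcc_site_closed {M : ℕ} {z : Fin M → E3} {c k : Fin M} {G : E3 →L[ℝ] E3} {ρ r : ℝ}
    (hrange : Set.range z = {x : E3 | dist x (z c) ≤ 133 / 10 ∧ ∃ a : Fin 3 → ℤ, x = z c + latPt G fccVec a})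
    (hk : dist (z k) (z c) ≤ ρ) (hr : r + ρ ≤ 133 / 10) :
    ∀ x : E3, dist x (z k) ≤ r → (x ∈ Set.range z ↔ x - z k ∈ {v : E3 | ∃ b : Fin 3 → ℤ, v = latPt G fccVec b}) := by
  have hkmem : z k ∈ Set.range z := ⟨k, rfl⟩
  rw [hrange] at hkmem
  obtain ⟨-, ak, hak⟩ := hkmem
  intro x hx
  rw [hrange]
  constructor
  · rintro ⟨-, a, ha⟩
    exact ⟨a - ak, by rw [latPt_sub, ha, hak]; abel⟩
  · rintro ⟨b, hb⟩
    refine ⟨by linarith [dist_triangle x (z k) (z c)], ak + b, ?_⟩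
    rw [latPt_add, ← sub_add_cancel x (z k), hb, hak]
    abel

/-- ★ **hcp ball, A-site within `ρ` of the centre, open radius `r`** (`r + ρ ≤ 133/10`): displacement set `T_A`. [folklore] -/
theorem locHom_hcpA_site {M : ℕ} {z : Fin M → E3} {c k : Fin M} {G : E3 →L[ℝ] E3} {ξ : E3} {ρ r : ℝ}
    (hrange : Set.range z = {x : E3 | dist x (z c) ≤ 133 / 10 ∧ ∃ a : Fin 3 → ℤ,
      x = z c + latPt G hexFrame a ∨ x = z c + latPt G hexFrame a + G (hcpShift + ξ)})
    (hk : dist (z k) (z c) ≤ ρ) (hr : r + ρ ≤ 133 / 10) {ak : Fin 3 → ℤ} (hak : z k = z c + latPt G hexFrame ak) :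
    ∀ x : E3, dist x (z k) < r → (x ∈ Set.range z ↔
      x - z k ∈ {v : E3 | ∃ b : Fin 3 → ℤ, v = latPt G hexFrame b ∨ v = latPt G hexFrame b + G (hcpShift + ξ)}) := by
  intro x hx
  rw [hrange]
  constructor
  · rintro ⟨-, a, ha | ha⟩
    · exact ⟨a - ak, Or.inl (by rw [latPt_sub, ha, hak]; abel)⟩
    · exact ⟨a - ak, Or.inr (by rw [latPt_sub, ha, hak]; abel)⟩
  · rintro ⟨b, hb | hb⟩
    · refine ⟨by linarith [dist_triangle x (z k) (z c)], ak + b, Or.inl ?_⟩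
      rw [latPt_add, ← sub_add_cancel x (z k), hb, hak]
      abel
    · refine ⟨by linarith [dist_triangle x (z k) (z c)], ak + b, Or.inr ?_⟩
      rw [latPt_add, ← sub_add_cancel x (z k), hb, hak]
      abel

/-- ★ **hcp ball, B-site, open radius**: displacement set `T_B = G·L_hex ∪ (G·L_hex − u)`. [folklore] -/
theorem locHom_hcpB_site {M : ℕ} {z : Fin M → E3} {c k : Fin M} {G : E3 →L[ℝ] E3} {ξ : E3} {ρ r : ℝ}
    (hrange : Set.range z = {x : E3 | dist x (z c) ≤ 133 / 10 ∧ ∃ a : Fin 3 → ℤ,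
      x = z c + latPt G hexFrame a ∨ x = z c + latPt G hexFrame a + G (hcpShift + ξ)})
    (hk : dist (z k) (z c) ≤ ρ) (hr : r + ρ ≤ 133 / 10) {ak : Fin 3 → ℤ} (hak : z k = z c + latPt G hexFrame ak + G (hcpShift + ξ)) :
    ∀ x : E3, dist x (z k) < r → (x ∈ Set.range z ↔
      x - z k ∈ {v : E3 | ∃ b : Fin 3 → ℤ, v = latPt G hexFrame b ∨ v = latPt G hexFrame b - G (hcpShift + ξ)}) := by
  intro x hx
  rw [hrange]
  constructor
  · rintro ⟨-, a, ha | ha⟩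
    · exact ⟨a - ak, Or.inr (by rw [latPt_sub, ha, hak]; abel)⟩
    · exact ⟨a - ak, Or.inl (by rw [latPt_sub, ha, hak]; abel)⟩
  · rintro ⟨b, hb | hb⟩
    · refine ⟨by linarith [dist_triangle x (z k) (z c)], ak + b, Or.inr ?_⟩
      rw [latPt_add, ← sub_add_cancel x (z k), hb, hak]
      abel
    · refine ⟨by linarith [dist_triangle x (z k) (z c)], ak + b, Or.inl ?_⟩
      rw [latPt_add, ← sub_add_cancel x (z k), hb, hak]
      abel

/-- From open homogeneity at a larger radius to closed homogeneity at a smaller one. [formal bookkeeping] -/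
theorem locHom_closed_of_open {M : ℕ} {z : Fin M → E3} {j : Fin M} {T : Set E3} {r r' : ℝ} (hrr : r < r')
    (hT : ∀ x : E3, dist x (z j) < r' → (x ∈ Set.range z ↔ x - z j ∈ T)) :
    ∀ x : E3, dist x (z j) ≤ r → (x ∈ Set.range z ↔ x - z j ∈ T) :=
  fun x hx => hT x (lt_of_le_of_lt hx hrr)

/-- ★ **Windowed local sum at a site** (closed radius-`7` homogeneity): `Σ_{k ≠ j, r_jk ≤ 7} F(z k − z j) = ∑ᶠ v ∈ {v ≠ 0 ∧ ‖v‖ ≤ 7 ∧ v ∈ T}, F v`. [folklore] -/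
theorem localSum_site_eq_windowSum {M : ℕ} {z : Fin M → E3} (hz : Function.Injective z) {j : Fin M} {T : Set E3}
    (hT : ∀ x : E3, dist x (z j) ≤ 7 → (x ∈ Set.range z ↔ x - z j ∈ T)) (F : E3 → ℝ) :
    ∑ k ∈ (Finset.univ.erase j).filter (fun k => dist (z k) (z j) ≤ 7), F (z k - z j) =
      ∑ᶠ v ∈ {v : E3 | v ≠ 0 ∧ ‖v‖ ≤ 7 ∧ v ∈ T}, F v := by
  rw [FrustratedLawDichotomyStrainedPatchHomPrunes.localSum_centre_eq_sum hz j F,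
    sum_eq_finsum_mem_of_locHom_closed hz hT (fun v : E3 => if v ≠ 0 ∧ ‖v‖ ≤ 7 then F v else 0) fun v hv => by
      have : ¬‖v‖ ≤ 7 := fun h => by linarith
      simp [this]]
  rw [finsum_mem_def, finsum_mem_def]
  congr 1
  funext v
  by_cases hv0 : v = 0
  · simp [Set.indicator, hv0]
  · by_cases hv7 : ‖v‖ ≤ 7
    · by_cases hvT : v ∈ T <;> simp [Set.indicator, hv0, hv7, hvT]
    · simp [Set.indicator, hv0, hv7]

/-! ## §2. The radial-spread obstruction with a small homogeneity radius -/

/-- A displacement `w ∈ T` of norm `< r` is a point of the ball (open homogeneity of radius `r`). [folklore] -/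
theorem mem_range_of_mem_r {M : ℕ} {z : Fin M → E3} {j : Fin M} {T : Set E3} {r : ℝ}
    (hT : ∀ x : E3, dist x (z j) < r → (x ∈ Set.range z ↔ x - z j ∈ T)) {w : E3} (hw : w ∈ T) (hwr : ‖w‖ < r) :
    z j + w ∈ Set.range z :=
  (hT (z j + w) (by simpa [dist_eq_norm] using hwr)).2 (by simpa using hw)

/-- ★ **(P2′) at any site with homogeneity radius `r`**: a shortest nonzero displacement `w₀` (against `T ∖ 0` up to `D`) and a displacement `w ∈ T`
with `(1 + η)‖w₀‖ < ‖w‖ < 13/10·‖w₀‖`, where `‖w₀‖, ‖w‖, D < r`, forbid `GoodAtScale η D z j` (`0 ≤ η`). [folklore] -/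
theorem not_goodAtScale_site_of_radialSpread {M : ℕ} {z : Fin M → E3} {j : Fin M} {T : Set E3} {r : ℝ}
    (hT : ∀ x : E3, dist x (z j) < r → (x ∈ Set.range z ↔ x - z j ∈ T)) {η D : ℝ} (hη0 : 0 ≤ η) (hD : D < r)
    {w₀ w : E3} (hw₀T : w₀ ∈ T) (hw₀0 : w₀ ≠ 0) (hw₀r : ‖w₀‖ < r) (hmin : ∀ w' ∈ T, w' ≠ 0 → ‖w'‖ ≤ D → ‖w₀‖ ≤ ‖w'‖)
    (hwT : w ∈ T) (hwr : ‖w‖ < r) (hlo : (1 + η) * ‖w₀‖ < ‖w‖) (hhi : ‖w‖ < 13 / 10 * ‖w₀‖) : ¬GoodAtScale η D z j := by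
  rintro ⟨d, η', γ, A, hdD, hor⟩
  have key : ∀ {P : Finset E3} (t : ↥P → E3), (∀ u : ↥P, ‖(u : E3)‖ = 1) → 0 < d → 0 < γ → η' < η →
      (∀ u : ↥P, t u ∈ Set.range z ∧ ‖(t u - z j) - d • A (u : E3)‖ ≤ η' * d) →
      (∀ s : E3, s ∈ Set.range z → s ≠ z j → d ≤ dist s (z j)) →
      (∃ s : E3, s ∈ Set.range z ∧ s ≠ z j ∧ dist s (z j) ≤ d) →
      (∀ s : E3, s ∈ Set.range z → s ≠ z j → dist s (z j) < 13 / 10 * d + γ → dist s (z j) ≤ 13 / 10 * d - γ ∧ s ∈ Set.range t) → False := by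
    intro P t hP1 hd0 hγ0 hη hfit hlow hex hclean
    have hd1 : d ≤ ‖w₀‖ := by
      have := hlow (z j + w₀) (mem_range_of_mem_r hT hw₀T hw₀r) (fun h => hw₀0 (by simpa using h))
      simpa [dist_eq_norm] using this
    have hd2 : ‖w₀‖ ≤ d := by
      obtain ⟨s, hs, hne, hsd⟩ := hex
      have hw' : s - z j ∈ T := (hT s (by linarith)).1 hs
      have hsd' : ‖s - z j‖ ≤ d := by rwa [← dist_eq_norm]
      exact (hmin _ hw' (sub_ne_zero.2 hne) (by linarith)).trans hsd'
    have hw0 : w ≠ 0 := by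
      intro h
      rw [h, norm_zero] at hlo
      nlinarith [norm_nonneg w₀]
    have hxmem := mem_range_of_mem_r hT hwT hwr
    obtain ⟨-, u, hu⟩ := hclean (z j + w) hxmem (fun h => hw0 (by simpa using h)) (by
      have : dist (z j + w) (z j) = ‖w‖ := by simp [dist_eq_norm]
      rw [this]; nlinarith)
    have hfu := (hfit u).2
    rw [hu, add_sub_cancel_left] at hfu
    have hAu : ‖d • A (u : E3)‖ = d := by
      rw [norm_smul, LinearIsometry.norm_map, hP1 u, mul_one, Real.norm_eq_abs, abs_of_pos hd0]
    have hle : ‖w‖ ≤ d + η' * d := by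
      calc ‖w‖ ≤ ‖d • A (u : E3)‖ + ‖w - d • A (u : E3)‖ := norm_le_insert' _ _
        _ ≤ d + η' * d := by rw [hAu]; linarith
    have hdd : d = ‖w₀‖ := le_antisymm hd1 hd2
    rw [hdd] at hle
    nlinarith [norm_nonneg w₀]
  rcases hor with ⟨t, hd0, hγ0, hη, hfit, hlow, hex, hclean⟩ | ⟨t, hd0, hγ0, hη, hfit, hlow, hex, hclean⟩
  · exact key t (fun u => norm_eq_one_of_mem_fccKissingPattern u.2) hd0 hγ0 hη hfit hlow hex hclean
  · exact key t (fun u => norm_eq_one_of_mem_hcpKissingPattern u.2) hd0 hγ0 hη hfit hlow hex hclean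

/-! ## §3. Removal- and move-stability at a site from window data -/

/-- ★ **Removal stability at a site**: `Σ_window V_LJ‖v‖ ≤ e + t + T♯(7) ⟹ ¬RemovalUnstableCore e t 7` (closed radius-`7` homogeneity). [folklore] -/
theorem not_removalUnstableCore_site_of_windowSum_le {M : ℕ} {z : Fin M → E3} (hz : Function.Injective z) {j : Fin M} {T : Set E3}
    (hT : ∀ x : E3, dist x (z j) ≤ 7 → (x ∈ Set.range z ↔ x - z j ∈ T)) {e t : ℝ}
    (hle : ∑ᶠ v ∈ {v : E3 | v ≠ 0 ∧ ‖v‖ ≤ 7 ∧ v ∈ T}, lennardJones ‖v‖ ≤ e + t + tailConstSharp 7) :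
    ¬RemovalUnstableCore e t 7 M z j := by
  intro h
  unfold RemovalUnstableCore at h
  have hR : ∑ k ∈ (Finset.univ.erase j).filter (fun k => dist (z k) (z j) ≤ 7), lennardJones (dist (z j) (z k)) =
      ∑ᶠ v ∈ {v : E3 | v ≠ 0 ∧ ‖v‖ ≤ 7 ∧ v ∈ T}, lennardJones ‖v‖ := by
    rw [← localSum_site_eq_windowSum hz hT (fun v => lennardJones ‖v‖)]
    refine Finset.sum_congr rfl fun k _ => ?_
    rw [dist_comm, dist_eq_norm]
  rw [hR] at h
  linarith

/-- ★ **One-atom MOVE STABILITY at a site** (closed radius-`7` homogeneity): if for every step bound `s ∈ [0, 3/2]` and every displacement `q`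
with `‖q‖ ≤ s`, `‖q‖ < 7/10` the window energy does not drop by more than the move slack,
`Σ_w V_LJ‖v‖ ≤ Σ_w V_LJ‖q − v‖ + (0 + s·(7/(7−s))⁷·S₇♯(7))`, then `¬MoveUnstableCore 0 7 s` at the site for all such `s`. [folklore] -/
theorem not_moveUnstableCore_site_of_stable {M : ℕ} {z : Fin M → E3} (hz : Function.Injective z) {j : Fin M} {T : Set E3}
    (hT : ∀ x : E3, dist x (z j) ≤ 7 → (x ∈ Set.range z ↔ x - z j ∈ T))
    (hstab : ∀ s : ℝ, 0 ≤ s → s ≤ 3 / 2 → ∀ q : E3, ‖q‖ ≤ s → ‖q‖ < 7 / 10 →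
      ∑ᶠ v ∈ {v : E3 | v ≠ 0 ∧ ‖v‖ ≤ 7 ∧ v ∈ T}, lennardJones ‖v‖ ≤
        (∑ᶠ v ∈ {v : E3 | v ≠ 0 ∧ ‖v‖ ≤ 7 ∧ v ∈ T}, lennardJones ‖q - v‖) +
          (0 + s * (7 / (7 - s)) ^ 7 * (6000 / 343 * (7 : ℝ)⁻¹ ^ 4 + 2880 / 49 * (7 : ℝ)⁻¹ ^ 5 + 10 / 7 * (7 : ℝ)⁻¹ ^ 6 + 2 * (7 : ℝ)⁻¹ ^ 7)))
    {s : ℝ} (hs0 : 0 ≤ s) (hs1 : s ≤ 3 / 2) : ¬MoveUnstableCore 0 7 s M z j := by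
  rintro ⟨p, hps, hp7, hlt⟩
  set q : E3 := p - z j with hq
  have hqs : ‖q‖ ≤ s := by rwa [hq, ← dist_eq_norm]
  have hq7 : ‖q‖ < 7 / 10 := by rwa [hq, ← dist_eq_norm]
  have hL : ∑ k ∈ (Finset.univ.erase j).filter (fun k => dist (z k) (z j) ≤ 7), lennardJones (dist p (z k)) =
      ∑ᶠ v ∈ {v : E3 | v ≠ 0 ∧ ‖v‖ ≤ 7 ∧ v ∈ T}, lennardJones ‖q - v‖ := by
    rw [← localSum_site_eq_windowSum hz hT (fun v => lennardJones ‖q - v‖)]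
    refine Finset.sum_congr rfl fun k _ => ?_
    rw [dist_eq_norm, hq]
    congr 2
    abel
  have hR : ∑ k ∈ (Finset.univ.erase j).filter (fun k => dist (z k) (z j) ≤ 7), lennardJones (dist (z j) (z k)) =
      ∑ᶠ v ∈ {v : E3 | v ≠ 0 ∧ ‖v‖ ≤ 7 ∧ v ∈ T}, lennardJones ‖v‖ := by
    rw [← localSum_site_eq_windowSum hz hT (fun v => lennardJones ‖v‖)]
    refine Finset.sum_congr rfl fun k _ => ?_
    rw [dist_comm, dist_eq_norm]
  rw [hL, hR] at hlt
  have := hstab s hs0 hs1 q hqs hq7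
  linarith

end Summit.AtomisticToContinuum.Crystallization.Theorems.FrustratedLawDichotomyStrainedPatchHomWitnessSite

end
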